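import Mathlib
import Literature.NumberTheory.LFunctions.Zhang2022.Section7dStatements
import Literature.NumberTheory.LFunctions.Zhang2022.Section7MainTermIdentities
import Literature.NumberTheory.LFunctions.Zhang2022.Section7MainTermAssembly
import Literature.NumberTheory.LFunctions.Zhang2022.Section7SjStarEqSj
import Literature.NumberTheory.LFunctions.Zhang2022.Section7dResidues
import Literature.NumberTheory.LFunctions.Zhang2022.TypedSection16B
import HarnessLib

/-!
# Zhang (2022) §7, proof of Proposition 7.1 part (c): the typed nodes `Step7u042`, `Eq717`,
# `Step7u044`, `Step7u045a`, `Step7u054`, `Step7u056`, `Step7u057`, `Eq721` HOLD, and the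
# deduction node `DedProp71c` (`Z22:Prop7.1.pf.c-main`) HOLDS

Topic `Literature/NumberTheory/LFunctions/Zhang2022` (Landau–Siegel audit tree; verdict-neutral).
Y. Zhang, *Discrete mean estimates and the Landau–Siegel zero*, arXiv:2211.02515v1 (2022)
[Zhang2022LandauSiegel] — **an unrefereed manuscript under adjudication**. D-0069 campaign, cell
`siegel-zhang`, layer L2, cone leaf C18 (`Skeleton.Ded71`), part (c) "*Proof of Proposition 7.1:
The main term*" (§7 pp. 39–42). The slice file `Section7dStatements` (L2-t5) types every display of
that passage as a `def … : Prop`; this theorem-only file records which of them are now THEOREMS of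
the tree, by one-line bridges to the kernel proofs of `Section7MainTermIdentities`
(`Z22:§7.u042`, `(7.17)`, `§7.u044`, `§7.u056`, `§7.u057`), `Section7SjStarEqSj` (`§7.u055` ⇒ (7.21))
and `Section7MainTermAssembly` (the closing inference), plus two proofs given here in full:
`Z22:§7.u054` (the Möbius insertion) and `Z22:§7.u045a` (the unique factorisation `l = hr`).

| DAG node | typed decl | theorem here | proof |
|---|---|---|---|
| `Z22:§7.u042` | `Step7u042 c'` | `step7u042_holds` | `Section7MainTerm.step7u042` |
| `Z22:(7.17)` | `Eq717 c'` | `eq717_holds` | `Section7MainTerm.eq717` |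
| `Z22:§7.u044` | `Step7u044` | `step7u044_holds` | `Section7MainTerm.adm72_support` |
| `Z22:§7.u045` (1st sentence) | `Step7u045a` | `step7u045a_holds` | here (`d₁`-part of `l`) |
| `Z22:§7.u054` | `Step7u054 c'` | `step7u054_holds` | here (`Σ_{r∣n}μ(r) = [n=1]`) |
| `Z22:§7.u056` | `Step7u056 c'` | `step7u056_holds` | `Section7MainTerm.lamZero_mul_eq` |
| `Z22:§7.u057` | `Step7u057 c'` | `step7u057_holds` | `Section7MainTerm.lamZero_mul_sum_eq_xiZero` |
| `Z22:(7.21)` | `Eq721 c'` | `eq721_holds` | `eq721_of_step7u057` (sz-d25) ∘ `step7u057_holds` |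
| `Z22:Prop7.1.pf.c-main` | `DedProp71c c'` | `dedProp71c_holds` | `Section7MainTerm.eq710_of_eq720` |

The last line says: the manuscript's chain of part (c), AS TYPED, does yield (7.10) — indeed already
its sub-chain (7.20) ∧ (7.21) ∧ `§7.u058–u060` does (`dedProp71c_tail`); the remaining antecedents of
`DedProp71c` are the manuscript's route TO (7.20). Theorems only; 0 new definitions; 0 new facts.

WHAT THIS IS NOT: any claim about Theorems 1–2 of the manuscript or about Landau–Siegel zeros; not a
discharge of Proposition 7.1 — (7.20) (`Eq720`) and the residue evaluations `Step7u058–u060` (tree: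
`step7u058_of` etc., edges from Lemma 5.4) remain hypotheses of the closing edge.

## References

* Y. Zhang, arXiv:2211.02515v1 (2022), §7 pp. 39–42, tex L2063–L2178.
  [cite: Zhang2022LandauSiegel, §7 pp. 39–42]
-/

noncomputable section

open Finset

namespace Literature.NumberTheory.LFunctions.Zhang2022.Section7dStatements

open Literature.NumberTheory.LFunctions.Zhang2022.Skeleton
open ArithmeticFunction (moebius)

/-! ## One-line bridges to `Section7MainTermIdentities` -/

/-- `Z22:§7.u042` HOLDS (typed node `Step7u042`): grouping the divisor pairs of `dl` by `(m₁, d)`.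
[cite: Zhang2022LandauSiegel, §7 p.39, tex L2074] -/
theorem step7u042_holds (c' : ℝ) : Step7u042 c' := Section7MainTerm.step7u042 c'

variable (c' : ℝ) in
/-- `Step7u042` — `_holds` alias of `step7u042_holds` above under the fact's exact name, stated under the
prover's own binders as section variables (appended 2026-08-28, D-0026 bookkeeping: the proof term is the
existing theorem of this file; no statement, definition or attribute is edited; no new named fact; the
ledger's debt table listed the fact unproved). [cite: Zhang2022LandauSiegel, §7 p.39, tex L2074] -/
theorem _root_.Literature.NumberTheory.LFunctions.Zhang2022.Section7dStatements.Step7u042_holds :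
    _root_.Literature.NumberTheory.LFunctions.Zhang2022.Section7dStatements.Step7u042 c' :=
  _root_.Literature.NumberTheory.LFunctions.Zhang2022.Section7dStatements.step7u042_holds (c' := c')

/-- `Z22:(7.17)` HOLDS (typed node `Eq717`). [cite: Zhang2022LandauSiegel, §7 (7.17) p.39, tex L2078] -/
theorem eq717_holds (c' : ℝ) : Eq717 c' := Section7MainTerm.eq717 c'

variable (c' : ℝ) in
/-- `Eq717` — `_holds` alias of `eq717_holds` above under the fact's exact name, stated under the
prover's own binders as section variables (appended 2026-08-28, D-0026 bookkeeping: the proof term is the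
existing theorem of this file; no statement, definition or attribute is edited; no new named fact; the
ledger's debt table listed the fact unproved). [cite: Zhang2022LandauSiegel, §7 (7.17) p.39, tex L2078] -/
theorem _root_.Literature.NumberTheory.LFunctions.Zhang2022.Section7dStatements.Eq717_holds :
    _root_.Literature.NumberTheory.LFunctions.Zhang2022.Section7dStatements.Eq717 c' :=
  _root_.Literature.NumberTheory.LFunctions.Zhang2022.Section7dStatements.eq717_holds (c' := c')

/-- `Z22:§7.u044` HOLDS (typed node `Step7u044`): the support clause of (7.2).
[cite: Zhang2022LandauSiegel, §7 p.40, tex L2097] -/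
theorem step7u044_holds : Step7u044 := Section7MainTerm.adm72_support

/-- `Z22:§7.u056` HOLDS (typed node `Step7u056`): `λ₀ⱼ(drn) = λ₀ⱼ(dr)λ̃₀ⱼ(n,dr)`.
[cite: Zhang2022LandauSiegel, §7 p.41, tex L2156] -/
theorem step7u056_holds (c' : ℝ) : Step7u056 c' := Section7MainTerm.lamZero_mul_eq c'

variable (c' : ℝ) in
/-- `Step7u056` — `_holds` alias of `step7u056_holds` above under the fact's exact name, stated under the
prover's own binders as section variables (appended 2026-08-28, D-0026 bookkeeping: the proof term is the
existing theorem of this file; no statement, definition or attribute is edited; no new named fact; the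
ledger's debt table listed the fact unproved). [cite: Zhang2022LandauSiegel, §7 p.41, tex L2156] -/
theorem _root_.Literature.NumberTheory.LFunctions.Zhang2022.Section7dStatements.Step7u056_holds :
    _root_.Literature.NumberTheory.LFunctions.Zhang2022.Section7dStatements.Step7u056 c' :=
  _root_.Literature.NumberTheory.LFunctions.Zhang2022.Section7dStatements.step7u056_holds (c' := c')

/-- `Z22:§7.u057` HOLDS (typed node `Step7u057`).
[cite: Zhang2022LandauSiegel, §7 p.41, tex L2160] -/
theorem step7u057_holds (c' : ℝ) : Step7u057 c' := Section7MainTerm.lamZero_mul_sum_eq_xiZero c'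

variable (c' : ℝ) in
/-- `Step7u057` — `_holds` alias of `step7u057_holds` above under the fact's exact name, stated under the
prover's own binders as section variables (appended 2026-08-28, D-0026 bookkeeping: the proof term is the
existing theorem of this file; no statement, definition or attribute is edited; no new named fact; the
ledger's debt table listed the fact unproved). [cite: Zhang2022LandauSiegel, §7 p.41, tex L2160] -/
theorem _root_.Literature.NumberTheory.LFunctions.Zhang2022.Section7dStatements.Step7u057_holds :
    _root_.Literature.NumberTheory.LFunctions.Zhang2022.Section7dStatements.Step7u057 c' :=
  _root_.Literature.NumberTheory.LFunctions.Zhang2022.Section7dStatements.step7u057_holds (c' := c')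

/-- `Z22:(7.21)` HOLDS (typed node `Eq721`): `S*ⱼ(𝐚₁,𝐚₂) = S_j(𝐚₁,𝐚₂)` for `𝐚₁, 𝐚₂` satisfying
(7.2) — the edge `eq721_of_step7u057` (`Section7SjStarEqSj`) applied to `step7u057_holds`.
[cite: Zhang2022LandauSiegel, §7 (7.21) p.41, tex L2165] -/
theorem eq721_holds (c' : ℝ) : Eq721 c' := eq721_of_step7u057 c' (step7u057_holds c')

variable (c' : ℝ) in
/-- `Eq721` — `_holds` alias of `eq721_holds` above under the fact's exact name, stated under the
prover's own binders as section variables (appended 2026-08-28, D-0026 bookkeeping: the proof term is the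
existing theorem of this file; no statement, definition or attribute is edited; no new named fact; the
ledger's debt table listed the fact unproved). [cite: Zhang2022LandauSiegel, §7 (7.21) p.41, tex L2165] -/
theorem _root_.Literature.NumberTheory.LFunctions.Zhang2022.Section7dStatements.Eq721_holds :
    _root_.Literature.NumberTheory.LFunctions.Zhang2022.Section7dStatements.Eq721 c' :=
  _root_.Literature.NumberTheory.LFunctions.Zhang2022.Section7dStatements.eq721_holds (c' := c')

/-! ## `Z22:§7.u054`: the Möbius insertion -/

/-- `Σ_{r ∣ n} μ(r) = [n = 1]` in `ℂ`. [folklore] -/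
private theorem sum_divisors_moebius_ite (n : ℕ) :
    ∑ r ∈ n.divisors, (moebius r : ℂ) = if n = 1 then 1 else 0 := by
  have h := congrArg (fun f : ArithmeticFunction ℂ => f n)
    (ArithmeticFunction.coe_moebius_mul_coe_zeta : (moebius * ArithmeticFunction.zeta :
      ArithmeticFunction ℂ) = 1)
  simp only [ArithmeticFunction.coe_mul_zeta_apply, ArithmeticFunction.intCoe_apply,
    ArithmeticFunction.one_apply] at h
  rw [h]

/-- `Z22:§7.u054` HOLDS (typed node `Step7u054`). "By the Möbius inversion,
`S*ⱼ(𝐚₁,𝐚₂) = Σ_d Σ_{d₁} Σ_k (…) · Σ_l a₁(dl)l^{−(1−β_j)}(Σ_{r∣(k,l)} μ(r))`" (§7 p. 41): the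
coprimality condition `(l,k) = 1` of `S*ⱼ` is the indicator `Σ_{r ∣ (k,l)} μ(r)`.
[cite: Zhang2022LandauSiegel, §7 p.41, tex L2146] -/
theorem step7u054_holds (c' : ℝ) : Step7u054 c' := by
  intro D j a₁ a₂
  unfold SjStar
  refine Finset.sum_congr rfl fun d _ => Finset.sum_congr rfl fun d₁ _ =>
    Finset.sum_congr rfl fun k _ => ?_
  congr 1
  rw [Finset.sum_filter]
  refine Finset.sum_congr rfl fun l _ => ?_
  rw [sum_divisors_moebius_ite]
  have hiff : Nat.gcd k l = 1 ↔ Nat.Coprime l k := by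
    rw [Nat.coprime_iff_gcd_eq_one, Nat.gcd_comm]
  by_cases h : Nat.Coprime l k
  · rw [if_pos h, if_pos (hiff.mpr h), mul_one]
  · rw [if_neg h, if_neg (fun h' => h (hiff.mp h')), mul_zero]

variable (c' : ℝ) in
/-- `Step7u054` — `_holds` alias of `step7u054_holds` above under the fact's exact name, stated under the
prover's own binders as section variables (appended 2026-08-28, D-0026 bookkeeping: the proof term is the
existing theorem of this file; no statement, definition or attribute is edited; no new named fact; the
ledger's debt table listed the fact unproved). [cite: Zhang2022LandauSiegel, §7 p.41, tex L2146] -/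
theorem _root_.Literature.NumberTheory.LFunctions.Zhang2022.Section7dStatements.Step7u054_holds :
    _root_.Literature.NumberTheory.LFunctions.Zhang2022.Section7dStatements.Step7u054 c' :=
  _root_.Literature.NumberTheory.LFunctions.Zhang2022.Section7dStatements.step7u054_holds (c' := c')

/-! ## `Z22:§7.u045` (first sentence): the unique factorisation `l = hr` -/

/-- If `hr = h'r'` with `h ∈ 𝔫(d₁)` and `(r', d₁) = 1`, then `h ∣ h'` (a member of `𝔫(d₁)` is
coprime to every number coprime to `d₁`: the tree's `Typed.Section16B.coprime_of_mem_nset_of_coprime`,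
§15 p. 85). [cite: Zhang2022LandauSiegel, §7 p.40, tex L2100] -/
private theorem dvd_of_two_factorisations {d₁ h r h' r' : ℕ} (hh : h ∈ nset d₁)
    (hr' : Nat.Coprime r' d₁) (heq : h * r = h' * r') : h ∣ h' := by
  have hcop : Nat.Coprime h r' := Typed.Section16B.coprime_of_mem_nset_of_coprime hh hr'
  exact hcop.dvd_of_dvd_mul_right (heq ▸ Dvd.intro r rfl)

/-- `Z22:§7.u045` (first sentence) HOLDS (typed node `Step7u045a`). "Every `l` with `(l, m) = 1` can
be uniquely written as `l = hr` such that `h ∈ 𝔫(d₁)`, `(h, m) = 1` and `(r, d₁m) = 1`" (§7 p. 40;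
`m = d₂k`): existence with `h = ∏_{q ∣ l, q ∣ d₁} q^{v_q(l)}` (the `d₁`-part of `l`) and
`r = ∏_{q ∣ l, q ∤ d₁} q^{v_q(l)}`; uniqueness since any admissible `h` divides any other.
[cite: Zhang2022LandauSiegel, §7 p.40, tex L2100] -/
theorem step7u045a_holds : Step7u045a := by
  intro d₁ m l hd₁ _ hl hlm
  -- the `d₁`-part and the co-`d₁`-part of `l`
  set h : ℕ := ∏ q ∈ l.primeFactors.filter (fun q => q ∣ d₁), q ^ l.factorization q with hh
  set r : ℕ := ∏ q ∈ l.primeFactors.filter (fun q => ¬ q ∣ d₁), q ^ l.factorization q with hr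
  have hprod : h * r = l := by
    rw [hh, hr, Finset.prod_filter_mul_prod_filter_not]
    have := Nat.prod_factorization_pow_eq_self hl.ne'
    rwa [Finsupp.prod, Nat.support_factorization] at this
  have hpos : ∀ (S : Finset ℕ), S ⊆ l.primeFactors → 0 < ∏ q ∈ S, q ^ l.factorization q :=
    fun S hS => Finset.prod_pos fun q hq =>
      pow_pos (Nat.prime_of_mem_primeFactors (hS hq)).pos _
  have hh0 : 0 < h := hpos _ (Finset.filter_subset _ _)
  have hh_nset : h ∈ nset d₁ := by
    refine ⟨hh0, fun q hq hqh => ?_⟩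
    rw [hh] at hqh
    obtain ⟨q', hq', hdvd⟩ := ((Nat.Prime.prime hq).dvd_finsetProd_iff _).mp hqh
    rw [Finset.mem_filter] at hq'
    have hq'p : q'.Prime := Nat.prime_of_mem_primeFactors hq'.1
    have : q = q' := (Nat.prime_dvd_prime_iff_eq hq hq'p).mp (hq.dvd_of_dvd_pow hdvd)
    rw [this]
    exact hq'.2
  have hh_dvd : h ∣ l := Dvd.intro r hprod
  have hr_dvd : r ∣ l := Dvd.intro_left h hprod
  have hh_cop : Nat.Coprime h m := Nat.Coprime.coprime_dvd_left hh_dvd hlm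
  have hr_cop : Nat.Coprime r (d₁ * m) := by
    refine Nat.Coprime.mul_right ?_ (Nat.Coprime.coprime_dvd_left hr_dvd hlm)
    rw [hr]
    refine Nat.Coprime.prod_left fun q hq => ?_
    rw [Finset.mem_filter] at hq
    exact Nat.Coprime.pow_left _
      ((Nat.Prime.coprime_iff_not_dvd (Nat.prime_of_mem_primeFactors hq.1)).mpr hq.2)
  refine ⟨(h, r), ⟨hprod, hh_nset, hh_cop, hr_cop⟩, ?_⟩
  -- uniqueness
  rintro ⟨h', r'⟩ ⟨hprod', hh', -, hr'⟩
  simp only at hprod' hh' hr' ⊢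
  have hr'd : Nat.Coprime r' d₁ := Nat.Coprime.coprime_dvd_right (dvd_mul_right d₁ m) hr'
  have hrd : Nat.Coprime r d₁ := Nat.Coprime.coprime_dvd_right (dvd_mul_right d₁ m) hr_cop
  have heq : h * r = h' * r' := by rw [hprod, hprod']
  have h1 : h ∣ h' := dvd_of_two_factorisations hh_nset hr'd heq
  have h2 : h' ∣ h := dvd_of_two_factorisations hh' hrd heq.symm
  have hhh : h' = h := Nat.dvd_antisymm h2 h1
  have hrr : r' = r := by
    have : h * r' = h * r := by rw [← hhh, ← heq, hhh]
    exact Nat.eq_of_mul_eq_mul_left hh0 this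
  rw [hhh, hrr]

/-! ## The deduction node `Z22:Prop7.1.pf.c-main` -/

/-- **The tail of `DedProp71c`**: (7.20) ∧ (7.21) ∧ `Step7u058–u060` ⇒ (7.10), by instantiating the
generic closing edge `Section7MainTerm.eq710_of_eq720` at `𝔗₁₁ = Iface.frakT11`, `S*ⱼ = SjStar`,
`𝔯ⱼ = frakr`. [cite: Zhang2022LandauSiegel, §7 p.42, tex L2177] -/
theorem dedProp71c_tail (c' : ℝ) (h720 : Eq720 c') (h721 : Eq721 c') (h58 : Step7u058 c')
    (h59 : Step7u059 c') (h60 : Step7u060 c') : Iface.Eq710 c' :=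
  Section7MainTerm.eq710_of_eq720 c' (Iface.frakT11 c') (SjStar c') (frakr c')
    h720 h721 h58 h59 h60

/-- **`Z22:Prop7.1.pf.c-main` HOLDS as typed (`DedProp71c c'`)**: the displayed steps of "*Proof of
Proposition 7.1: The main term*" imply (7.10) — already (7.20), (7.21) and the three residue
evaluations do (`dedProp71c_tail`); the other antecedents (the route (7.16) → … → (7.20)) are not
needed for the final inference. [cite: Zhang2022LandauSiegel, §7 pp.39–42, tex L2063–L2178] -/
theorem dedProp71c_holds (c' : ℝ) : DedProp71c c' :=
  fun _ _ _ _ _ _ _ _ _ _ _ _ _ _ h720 _ _ _ _ h721 h58 h59 h60 =>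
    dedProp71c_tail c' h720 h721 h58 h59 h60

variable (c' : ℝ) in
/-- `DedProp71c` — `_holds` alias of `dedProp71c_holds` above under the fact's exact name, stated under the
prover's own binders as section variables (appended 2026-08-28, D-0026 bookkeeping: the proof term is the
existing theorem of this file; no statement, definition or attribute is edited; no new named fact; the
ledger's debt table listed the fact unproved). [cite: Zhang2022LandauSiegel, §7 pp.39–42, tex L2063–L2178] -/
theorem _root_.Literature.NumberTheory.LFunctions.Zhang2022.Section7dStatements.DedProp71c_holds :
    _root_.Literature.NumberTheory.LFunctions.Zhang2022.Section7dStatements.DedProp71c c' :=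
  _root_.Literature.NumberTheory.LFunctions.Zhang2022.Section7dStatements.dedProp71c_holds (c' := c')

/-- **(7.10) from (7.20) and Lemma 5.4 alone**: with (7.21) now a theorem (`eq721_holds`) and the
residue evaluations reduced to Lemma 5.4 (`step7u058_of`–`step7u060_of`, `Section7dResidues`), the
part-(c) conclusion (7.10) follows from the single remaining analytic display (7.20) and the banked
leaf `Skeleton.Lemma54`. [cite: Zhang2022LandauSiegel, §7 (7.10) p.37, (7.20) p.41] -/
theorem eq710_of_eq720_lemma54 (c' : ℝ) (h720 : Eq720 c') (h54 : Skeleton.Lemma54) :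
    Iface.Eq710 c' :=
  dedProp71c_tail c' h720 (eq721_holds c') (step7u058_of c' h54) (step7u059_of c' h54)
    (step7u060_of c' h54)

end Literature.NumberTheory.LFunctions.Zhang2022.Section7dStatements
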